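import Summits.AtomisticToContinuum.HydrodynamicLimit.Theorems.DiluteSelfConsistency.Negative.Quantifiers
import Summits.AtomisticToContinuum.HydrodynamicLimit.Theorems.DiluteSelfConsistency.Negative.ProfileUniform
import Summits.AtomisticToContinuum.HydrodynamicLimit.Theorems.ImplosionDichotomyDenseExcursionTiedStaticsRatio

/-!
# `DiluteSelfConsistency`: the smallness threshold `∃ σ₀` is load-bearing even inside Alexander's range (stmt-3091)

Negative knowledge for the crux `ImplosionDichotomy.DiluteSelfConsistency` (stmt-AtomisticToContinuum-3091), from the
standing disprover's work file `Cruxes/DiluteSelfConsistency/Disproof.lean`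
(refuter-cdisprove-stmt-AtomisticToContinuum-3091-0); completes the load-bearing map of `Negative/Quantifiers.lean` with
the one hypothesis it left open, the SMALLNESS of `σ`.

`DiluteSelfConsistencyOnAlexanderRange` is the crux with `∃ σ₀ > 0, ∀ σ < σ₀` replaced by the fixed range `∀ σ < 1/2`
on which hard-sphere flow families exist (Alexander) — i.e. "dilute self-consistency needs no smallness beyond the
existence of the dynamics". It is FALSE (`diluteSelfConsistency_false_on_alexanderRange`), by an EXPLICIT equilibrium
computation at `σ = 1/20`: for the homogeneous profiles `(1, 0, 1)` the uniform smallness `e·2Mv₁σ³ ≤ 1/32` holds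
(`M = 1`, `v₁ = 4π/3 ≤ 16/3`, `e < 2.7183`), the LLN density is a constant `r` with `|r - 1| ≤ 16e²v₁σ³ ≤ 2/25`
(`PolynomialCompressionStatics.abs_rhoLim_sub_β_le`), the rest state `(r, 0, 1)` is an admissible classical solution
(tie by `tendstoHydroFieldsAt_zero_of_small`, flows by Alexander), and its packing `r/8000 ≥ 1.15·10⁻⁴` exceeds the level
`η = 10⁻⁴`. So the crux's `σ₀(η, profiles)` must tend to `0` with `η` for every profile (cf. `Negative/Tightness.lean`:
`σ₀³ ≤ 2η/M`), not merely sit below the geometric packing bound.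
-/

noncomputable section

namespace Summit.AtomisticToContinuum.HydrodynamicLimit.Theorems

open MeasureTheory Filter Set Topology
open Literature.MathematicalPhysics.KineticTheory Literature.Analysis.FluidPDE
open Literature.Analysis.FunctionSpaces
open Summit.AtomisticToContinuum.HydrodynamicLimit.Theses.ImplosionDichotomy

/-- `DiluteSelfConsistency` with the threshold `∃ σ₀ > 0, ∀ σ < σ₀` REPLACED by Alexander's range `∀ σ < 1/2`
(all else verbatim). -/
def DiluteSelfConsistencyOnAlexanderRange : Prop :=
  ∀ η : ℝ, 0 < η → ∀ (a₀ θ₀ : T3 → ℝ) (u₀ : T3 → V3), Continuous a₀ → Continuous θ₀ → Continuous u₀ →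
    (∀ x, 0 < a₀ x) → (∀ x, 0 < θ₀ x) → ∀ σ : ℝ, 0 < σ → σ < 1 / 2 →
      ∀ (T : ℝ) (ρ θ : ℝ → T3 → ℝ) (u : ℝ → T3 → V3), IsHardSphereEulerSolution σ T ρ u θ →
        ∀ Φ : (N : ℕ) → HardSphereFlow (Torus.geometry (Fin 3)) (hsDiameter σ N) (N + 1),
          TendstoHydroFieldsAt (fun N => localGibbsLaw σ a₀ u₀ θ₀ N (Φ N)) Φ ρ u θ 0 →
            ∀ t ∈ Ico 0 T, ∀ x, ρ t x * σ ^ 3 < η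

open DiluteSelfConsistencyNegative DiluteSelfConsistencyProfileUniformNeg

/-- **SMALLNESS OF `σ` IS LOAD-BEARING, quantitatively and inside Alexander's range**: at `σ = 1/20` the homogeneous
admissible rest state (LLN density `r ≥ 23/25`) has packing `r/8000 > 10⁻⁴`, so the crux with `∀ σ < 1/2` in place of
`∃ σ₀, ∀ σ < σ₀` fails at level `η = 10⁻⁴`. Explicit statics: `e·2Mv₁σ³ ≤ 1/32` and `16e²v₁M²σ³ ≤ 2/25` from
`M = 1`, `v₁ = 4π/3 ≤ 16/3`, `e < 2.7182818286`. [folklore] -/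
theorem diluteSelfConsistency_false_on_alexanderRange : ¬ DiluteSelfConsistencyOnAlexanderRange := by
  intro h
  have hc : Continuous fun _ : T3 => (1 : ℝ) := continuous_const
  have hp : ∀ _ : T3, (0 : ℝ) < 1 := fun _ => one_pos
  set P := profileOf (fun _ => (1 : ℝ)) hc hp with hP
  -- `β ≡ 1`, `0 < M ≤ 1`
  have hβ : ∀ x, P.β x = 1 := fun x => by rw [hP, profileOf_β]; simp
  have hM1 : P.M ≤ 1 := csSup_le (range_nonempty _) (by rintro _ ⟨y, rfl⟩; rw [hβ y])
  have hM0 : 0 < P.M := P.M_pos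
  -- the constants
  have he : Real.exp 1 < 2.7182818286 := Real.exp_one_lt_d9
  have he0 : 0 < Real.exp 1 := Real.exp_pos 1
  have hv : v₁ ≤ 16 / 3 := by rw [TiedStaticsRatio.v₁_eq]; linarith [Real.pi_le_four]
  have hv0 : 0 < v₁ := v₁_pos
  -- `σ = 1/20`
  set σ : ℝ := 1 / 20 with hσdef
  have hσ : (0 : ℝ) < σ := by norm_num
  have hσ2 : σ < 1 / 2 := by norm_num
  have hσ3 : σ ^ 3 = 1 / 8000 := by norm_num
  -- uniform smallness `e·2Mv₁σ³ ≤ 1/32`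
  have hsmall : Real.exp 1 * (2 * P.M * v₁ * σ ^ 3) ≤ 1 / 32 := by
    rw [hσ3]
    have hev : Real.exp 1 * v₁ ≤ 2.7182818286 * (16 / 3) := mul_le_mul he.le hv hv0.le (by norm_num)
    have h2 : Real.exp 1 * v₁ * P.M ≤ 2.7182818286 * (16 / 3) * 1 := mul_le_mul hev hM1 hM0.le (by norm_num)
    calc Real.exp 1 * (2 * P.M * v₁ * (1 / 8000)) = Real.exp 1 * v₁ * P.M * (2 / 8000) := by ring
      _ ≤ 2.7182818286 * (16 / 3) * 1 * (2 / 8000) := mul_le_mul_of_nonneg_right h2 (by norm_num)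
      _ ≤ 1 / 32 := by norm_num
  have hPs : SmallDensity P σ :=
    UniformLGC.smallDensity_of_eta_le (Mstar := 2 * P.M) hσ hσ2 (by linarith) hsmall
  have hθP : geomRatio P σ ≤ 1 / 16 := by
    rw [geomRatio, ovDensity]
    calc 2 * Real.exp 1 * (P.M * v₁ * σ ^ 3) = Real.exp 1 * (2 * P.M * v₁ * σ ^ 3) := by ring
      _ ≤ 1 / 16 := hsmall.trans (by norm_num)
  -- the LLN density is a constant `r ≥ 23/25`
  set r : ℝ := rhoLim P σ 0 with hr
  have hrx : ∀ x, rhoLim P σ x = r := fun x => rhoLim_const_profile hc hp σ x 0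
  have hr0 : 0 < r := UniformLGC.rhoLim_pos_of_geomRatio_le hPs hθP 0
  have hdev : |r - 1| ≤ 16 * Real.exp 1 ^ 2 * v₁ * P.M ^ 2 * σ ^ 3 := by
    have := PolynomialCompressionStatics.abs_rhoLim_sub_β_le hPs 0
    rwa [hβ 0] at this
  have hr_ge : 23 / 25 ≤ r := by
    have h1 : 16 * Real.exp 1 ^ 2 * v₁ * P.M ^ 2 * σ ^ 3 ≤ 2 / 25 := by
      rw [hσ3]
      have he2 : Real.exp 1 ^ 2 ≤ 2.7182818286 ^ 2 := pow_le_pow_left₀ he0.le he.le 2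
      have hM2 : P.M ^ 2 ≤ 1 := pow_le_one₀ hM0.le hM1
      have h3 : Real.exp 1 ^ 2 * v₁ * P.M ^ 2 ≤ 2.7182818286 ^ 2 * (16 / 3) * 1 :=
        mul_le_mul (mul_le_mul he2 hv hv0.le (by positivity)) hM2 (by positivity) (by positivity)
      calc 16 * Real.exp 1 ^ 2 * v₁ * P.M ^ 2 * (1 / 8000)
            = Real.exp 1 ^ 2 * v₁ * P.M ^ 2 * (16 / 8000) := by ring
        _ ≤ 2.7182818286 ^ 2 * (16 / 3) * 1 * (16 / 8000) := mul_le_mul_of_nonneg_right h3 (by norm_num)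
        _ ≤ 2 / 25 := by norm_num
    have h2 := (abs_le.1 (hdev.trans h1)).1
    linarith
  -- the admissible rest state at `σ = 1/20`; the bound fails at level `η = 10⁻⁴`, `t = 0`
  obtain ⟨Φ⟩ := DenseExcursionDichotomy.flows_nonempty hσ hσ2
  have hE := DenseExcursionUntied.isHardSphereEulerSolution_const σ 1 (0 : V3) hr0 one_pos
  have htie : TendstoHydroFieldsAt
      (fun N => localGibbsLaw σ (fun _ => (1 : ℝ)) (fun _ => (0 : V3)) (fun _ => (1 : ℝ)) N (Φ N)) Φ
      (fun _ _ => r) (fun _ _ => (0 : V3)) (fun _ _ => (1 : ℝ)) 0 :=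
    tendstoHydroFieldsAt_zero_of_small hc continuous_const continuous_const hp (fun _ => one_pos) hσ hσ2 hsmall Φ
      (funext fun x => (hrx x).symm) rfl rfl
  have hlt := h (1 / 10000) (by norm_num) (fun _ => 1) (fun _ => 1) (fun _ => 0) hc continuous_const
    continuous_const hp (fun _ => one_pos) σ hσ hσ2 1 _ _ _ hE Φ htie 0 ⟨le_rfl, one_pos⟩ 0
  rw [hσ3] at hlt
  linarith

end Summit.AtomisticToContinuum.HydrodynamicLimit.Theorems

end
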